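import Literature.MathematicalPhysics.QuantumFieldTheory.Balaban1983to89.Node00.BackgroundMapOfRecord
import Literature.MathematicalPhysics.QuantumFieldTheory.Balaban1983to89.B11Eq115Space

/-!
# `Balaban1983to89.Node00.BgCarriersOfRecord` — the CARRIERS of [B11]'s space (115) AT THE RECORD: the adjoint transport
# `R(U₀)` and the covariant gradient (3.3) of a bond function on Node00's own lattice `PBond (F.P K) 0`, the level maps of a
# domain sequence, the normed spaces `𝒴 = (115)` and `𝒵 = |·|_{(−3)}` with matrix fibre, the (19) presentation `ev`, and the
# type of `BgScheme`s over them — OURS (definitional; file 1 of the record-pinned instance road `M1`, no content of Bałaban)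

CITATION HEADER (LEAF RULE: pointers BY NAME only).  [Balaban1985Variational] = T. Bałaban, *Commun. Math. Phys.* **102**
(1985) 277–309, (115) p. 294 (the space `max{|A′|_{(−1)}, |∇^{U₀}A′|_{(−2)}}`), the sizes `|·|_{(−n)}` p. 286, (19) p. 281 (the
presentation `U′ = exp(iηA′)U₀`), (117) p. 294 (Prop. 6's scheme); [Balaban1985BackgroundPropagators] = *Commun. Math. Phys.*
**99** (1985) 389–434, (3.1)–(3.3) p. 390–391 (`R(U)X = UXU⁻¹`, the covariant derivative along a bond).  Tree inputs, by name:
`B11Eq115Space.{levWeight, levWeight.instFact, NegSup, NegSize, JetSup, JetSup.equiv, Space115, levOf, levOf_le}` (the ABSTRACT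
(115) calculus over arbitrary index types — this file only instantiates its parameters), `Setup.{Params.eta, Params.L_pos, Site,
Site.shift, PBond, GaugeField}` (positivity of `L`, `η` by name: `Node00.L_real_pos`, `B3GkZeroTorusRescaled.eta_pos` — not imported, re-derived in one line inside the two `Fact` theorems), `T4Continuum.T4Family` (`F.P K`, `F.L`, `P_L`), `Node00.DatumAvLayer.SU`,
`Node00.BackgroundMapOfRecord.BgScheme`; Mathlib's `LinearMap.mulLeft/mulRight`, `Matrix.specialUnitaryGroup`, and the
`L²`-operator norm on `Matrix (Fin N) (Fin N) ℂ` opened by `open scoped Matrix.Norms.L2Operator` exactly as in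
`Node00.CarriersB12Chart` (no instance is declared in this file).

WHAT THIS MODULE DOES (pub-ymgap `M1-PLAN.md` file 1; custodian census bus I.22624/I.22645).  `Node00.BackgroundMapOfRecord.BgScheme
F N 𝒴 𝒵 K k` abstracts [B11] Prop. 6's data over two normed spaces `𝒴, 𝒵`; every letter of the lit-side (115)/(117) calculus
(`B11Eq115Space`, `B11Eq111FrakG`, `B11Eq110GreenInverse`, `B11Eq129Minimizer`) is typed over GENERIC finite index types.  This
file supplies the record's index types and fibre, so that instantiating those letters at the record becomes substitution:
* §1 the positivity `Fact`s of `L` and `η = L^{-k}` that the (115) instances need, as THEOREMS (`factL`, `factEta`; bind them with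
  `haveI` — they are deliberately not instances; the bare inequalities are the tree's `Node00.L_real_pos`, `B3GkZeroTorusRescaled.eta_pos`);
* §2 `adTransportOfRecord U₀ b` = `R(U₀(b))X = U₀(b) X U₀(b)⁻¹` on `Matrix (Fin N) (Fin N) ℂ` for a background
  `U₀ : GaugeField (F.P K) 0 (SU N)` ((3.1) p. 390), ℂ-linear;
* §3 `nablaOfRecord η U₀` = the covariant gradient of a bond function, componentwise ((3.3) p. 391 with [B11] p. 294's `∇^{U₀}`):
  `(∇A)(b, ν) = η⁻¹ • (R(U₀⟨b.src, ν⟩) A⟨b.src + e_ν, b.dir⟩ − A b)`, a ℂ-LINEAR map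
  `(PBond (F.P K) 0 → M_N(ℂ)) →ₗ[ℂ] (PBond (F.P K) 0 × Fin (F.P K).d → M_N(ℂ))` — NATIVE on Node00's `PBond`/`Site.shift`
  (no bridge to `B9SectCLatticeCarrier.Bond` is needed at this stage);
* §4 the level maps `bondLev Ω k b = j(b.src)`, `pairLev Ω k (b, ν) = j(b.src)` of a domain sequence `Ω : ℕ → Set (Site (F.P K) 0)`
  (`B11Eq115Space.levOf`; both `≤ k`);
* §5 the carriers `Space115OfRecord F N K k Ω U₀ := Space115 (F.L) ((F.P K).eta k) (bondLev Ω k) (pairLev Ω k) (nablaOfRecord …)`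
  and `NegSizeOfRecord F N K k Ω n := NegSize (F.L) ((F.P K).eta k) (bondLev Ω k) n M_N(ℂ)`; under `[Fact (0 < (F.L : ℝ))]
  [Fact (0 < (F.P K).eta k)]` the kernel finds `NormedAddCommGroup` / `NormedSpace ℂ` / `CompleteSpace` for both (recorded as the
  theorems `instBundle115`, `instBundleNeg` returning the instances BY `inferInstance` — evidence that `BgScheme`'s and
  `BackgroundMapOfRecord` §5's instance binders are met);
* §6 `evOfRecord` = the (19) presentation read on (115): the identification of a jet with its bond function, ℂ-linear, injective;
* §7 `BgSchemeOn F N K k Ω U₀` = the TYPE `BgScheme F N (Space115OfRecord … U₀) (NegSizeOfRecord … 3) K k` of schemes over the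
  record carriers at background `U₀`.
HONEST LABELS.  (1) DEFINITIONAL: nothing of Bałaban is proved; every theorem is `rfl`/bookkeeping.  (2) CARRIER FORK (recorded, not
decided here): print's (115)-norm depends on the background `U₀ = U₀(V)` through `∇^{U₀}`, while `BgScheme` carries ONE `𝒴` for all
`V ∈ dom`; hence a record instance is either a FAMILY of schemes indexed by the background (`BgSchemeOn … U₀` with `dom ⊆ {V | bg V = U₀}`),
or a dependent-carrier edition of `BgScheme`, or the flat-gradient carrier `U₀ := 1` plus a norm-equivalence lemma — files 2/3 of
`M1-PLAN.md` choose; this file serves all three.  (3) FIBRE: `M_N(ℂ)` with the `L²`-operator norm (print's `|X|`), not `su(N)`: the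
Lie-algebra constraint is a predicate on values, carried by the consumers (as `ChartSUTok` does for the chart).  (4) `η := (F.P K).eta k
= L^{-k}` is the spacing of the fine lattice in step-`k` units (`Node00.BackgroundActionOfRecord.bgReg` reads `ε·η²` with the same `η`).
-/

open scoped Matrix.Norms.L2Operator

namespace Literature.MathematicalPhysics.QuantumFieldTheory.Balaban1983to89.Node00

open T4Continuum (T4Family)
open B11Eq115Space (Space115 NegSize JetSup levOf levOf_le)

noncomputable section

variable (F : T4Family) (N : ℕ)

/-! ## §1. Positivity facts for the weights `(L^{j}η)^n` -/

/-- The `Fact (0 < L)` the (115) instances consume (print: *«L is an odd, positive integer»*; a THEOREM, to be bound with `haveI` —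
not an instance; the bare inequality is `Node00.L_real_pos` / `TorusGeometry.cast_L_pos`). [cite: Balaban1987RG1, (0.1) p.251] -/
theorem factL : Fact (0 < (F.L : ℝ)) := ⟨Nat.cast_pos.mpr (F.P 0).L_pos⟩

/-- The `Fact (0 < η = L^{-k})` the (115) instances consume (a THEOREM, to be bound with `haveI` — not an instance; the bare inequality is
`B3GkZeroTorusRescaled.eta_pos (F.P K) k`). [cite: Balaban1987RG1, (1.1) p.260] -/
theorem factEta (K k : ℕ) : Fact (0 < (F.P K).eta k) := ⟨pow_pos (inv_pos.mpr (Nat.cast_pos.mpr (F.P K).L_pos)) k⟩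

/-! ## §2. The adjoint transport `R(U₀)X = U₀ X U₀⁻¹` ((3.1) p. 390) -/

/-- **`R(U₀(b))X = U₀(b)·X·U₀(b)⁻¹`** on `M_N(ℂ)`, bond by bond, for an `SU(N)`-valued background on the fine lattice; ℂ-linear in `X`.
[cite: Balaban1985BackgroundPropagators, (3.1) p.390] -/
def adTransportOfRecord {K : ℕ} (U₀ : GaugeField (F.P K) 0 (SU N)) (b : PBond (F.P K) 0) :
    Matrix (Fin N) (Fin N) ℂ →ₗ[ℂ] Matrix (Fin N) (Fin N) ℂ :=
  (LinearMap.mulLeft ℂ ((U₀ b : SU N) : Matrix (Fin N) (Fin N) ℂ)).comp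
    (LinearMap.mulRight ℂ (((U₀ b)⁻¹ : SU N) : Matrix (Fin N) (Fin N) ℂ))

variable {F N} in
/-- Unfolding: `R(U₀(b))X = U₀(b) X U₀(b)⁻¹`. [cite: Balaban1985BackgroundPropagators, (3.1) p.390] -/
theorem adTransportOfRecord_apply {K : ℕ} (U₀ : GaugeField (F.P K) 0 (SU N)) (b : PBond (F.P K) 0) (X : Matrix (Fin N) (Fin N) ℂ) :
    adTransportOfRecord F N U₀ b X
      = ((U₀ b : SU N) : Matrix (Fin N) (Fin N) ℂ) * X * (((U₀ b)⁻¹ : SU N) : Matrix (Fin N) (Fin N) ℂ) := by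
  simp only [adTransportOfRecord, LinearMap.comp_apply, LinearMap.mulRight_apply, LinearMap.mulLeft_apply, mul_assoc]

/-! ## §3. The covariant gradient `∇^{U₀}` of a bond function ((3.3) p. 391; [B11] (115) p. 294) -/

/-- **The covariant gradient of a function on the bonds of the fine lattice, componentwise**: with `A⟨x, μ⟩ = A_μ(x)`,
`(∇^{U₀}A)(⟨x, μ⟩, ν) = η⁻¹·(R(U₀⟨x, ν⟩) A_μ(x + e_ν) − A_μ(x))` — (3.3) applied to each component, the object `∇^{U₀}A′` of the size
`|∇^{U₀}A′|_{(−2)}` in (115); a ℂ-LINEAR map in `A`. [cite: Balaban1985BackgroundPropagators, (3.3) p.391] -/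
def nablaOfRecord {K : ℕ} (η : ℝ) (U₀ : GaugeField (F.P K) 0 (SU N)) :
    (PBond (F.P K) 0 → Matrix (Fin N) (Fin N) ℂ) →ₗ[ℂ] (PBond (F.P K) 0 × Fin (F.P K).d → Matrix (Fin N) (Fin N) ℂ) where
  toFun A p := ((η : ℂ)⁻¹) • (adTransportOfRecord F N U₀ ⟨p.1.src, p.2⟩ (A ⟨p.1.src.shift p.2, p.1.dir⟩) - A p.1)
  map_add' A B := by
    funext p; simp only [Pi.add_apply, map_add, smul_add, smul_sub]; abel
  map_smul' a A := by
    funext p; simp only [Pi.smul_apply, map_smul, RingHom.id_apply, smul_sub, smul_comm ((η : ℂ)⁻¹) a]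

variable {F N} in
/-- Unfolding (3.3) at a pair `(b, ν)`. [cite: Balaban1985BackgroundPropagators, (3.3) p.391] -/
theorem nablaOfRecord_apply {K : ℕ} (η : ℝ) (U₀ : GaugeField (F.P K) 0 (SU N)) (A : PBond (F.P K) 0 → Matrix (Fin N) (Fin N) ℂ)
    (b : PBond (F.P K) 0) (ν : Fin (F.P K).d) :
    nablaOfRecord F N η U₀ A (b, ν)
      = ((η : ℂ)⁻¹) • (adTransportOfRecord F N U₀ ⟨b.src, ν⟩ (A ⟨b.src.shift ν, b.dir⟩) - A b) := rfl

/-! ## §4. The level maps of a domain sequence ([B11] p. 286, (3) p. 278) -/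

/-- The level `j(b)` of a BOND: that of its initial point, for a domain sequence `Ω₀ ⊃ Ω₁ ⊃ … ⊃ Ω_k` of the fine lattice.
[cite: Balaban1985Variational, p.286] -/
def bondLev {K : ℕ} (Ω : ℕ → Set (Site (F.P K) 0)) (k : ℕ) : PBond (F.P K) 0 → ℕ := fun b => levOf Ω k b.src

/-- The level of a PAIR `(b, ν)` (a point of `∇A`): that of the bond's initial point. [cite: Balaban1985Variational, p.286, (115) p.294] -/
def pairLev {K : ℕ} (Ω : ℕ → Set (Site (F.P K) 0)) (k : ℕ) : PBond (F.P K) 0 × Fin (F.P K).d → ℕ := fun p => levOf Ω k p.1.src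

variable {F} in
/-- Unfolding. [cite: Balaban1985Variational, p.286] -/
theorem bondLev_apply {K : ℕ} (Ω : ℕ → Set (Site (F.P K) 0)) (k : ℕ) (b : PBond (F.P K) 0) : bondLev F Ω k b = levOf Ω k b.src := rfl

variable {F} in
/-- Unfolding. [cite: Balaban1985Variational, p.286] -/
theorem pairLev_apply {K : ℕ} (Ω : ℕ → Set (Site (F.P K) 0)) (k : ℕ) (p : PBond (F.P K) 0 × Fin (F.P K).d) :
    pairLev F Ω k p = levOf Ω k p.1.src := rfl

variable {F} in
/-- Levels are at most `k`. [cite: Balaban1985Variational, p.286] -/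
theorem bondLev_le {K : ℕ} (Ω : ℕ → Set (Site (F.P K) 0)) (k : ℕ) (b : PBond (F.P K) 0) : bondLev F Ω k b ≤ k := levOf_le Ω k _

variable {F} in
/-- Levels are at most `k`. [cite: Balaban1985Variational, p.286] -/
theorem pairLev_le {K : ℕ} (Ω : ℕ → Set (Site (F.P K) 0)) (k : ℕ) (p : PBond (F.P K) 0 × Fin (F.P K).d) : pairLev F Ω k p ≤ k :=
  levOf_le Ω k _

/-! ## §5. The carriers `𝒴 = (115)` and `𝒵 = |·|_{(−n)}` at the record -/

/-- **The space (115) at the record**: bond functions `PBond (F.P K) 0 → M_N(ℂ)` with the norm `max{|A′|_{(−1)}, |∇^{U₀}A′|_{(−2)}}`,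
weights `(L^{j(x)}η)^n`, `η = L^{-k}`, levels from the domain sequence `Ω`, gradient of the background `U₀`.
[cite: Balaban1985Variational, (115) p.294] -/
abbrev Space115OfRecord (K k : ℕ) (Ω : ℕ → Set (Site (F.P K) 0)) (U₀ : GaugeField (F.P K) 0 (SU N)) : Type :=
  Space115 (𝕜 := ℂ) (V := Matrix (Fin N) (Fin N) ℂ) (F.L : ℝ) ((F.P K).eta k) (bondLev F Ω k) (pairLev F Ω k)
    (nablaOfRecord F N ((F.P K).eta k) U₀)

/-- **The size `|·|_{(−n)}` at the record**: bond functions normed by `sup_b (L^{j(b)}η)^n |A(b)|` (the target `𝒵` of Prop. 6's scheme is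
`n = 3`). [cite: Balaban1985Variational, p.286, (117) p.294] -/
abbrev NegSizeOfRecord (K k : ℕ) (Ω : ℕ → Set (Site (F.P K) 0)) (n : ℕ) : Type :=
  NegSize (F.L : ℝ) ((F.P K).eta k) (bondLev F Ω k) n (Matrix (Fin N) (Fin N) ℂ)

variable {F N} in
/-- The instance bundle of (115) at the record is FOUND (normed group, ℂ-normed space, complete), given the two positivity facts.
[cite: Balaban1985Variational, (115) p.294] -/
theorem instBundle115 (K k : ℕ) (Ω : ℕ → Set (Site (F.P K) 0)) (U₀ : GaugeField (F.P K) 0 (SU N))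
    [Fact (0 < (F.L : ℝ))] [Fact (0 < (F.P K).eta k)] :
    Nonempty (NormedAddCommGroup (Space115OfRecord F N K k Ω U₀)) ∧ Nonempty (NormedSpace ℂ (Space115OfRecord F N K k Ω U₀))
      ∧ CompleteSpace (Space115OfRecord F N K k Ω U₀) :=
  ⟨⟨inferInstance⟩, ⟨inferInstance⟩, inferInstance⟩

variable {F N} in
/-- The instance bundle of `|·|_{(−n)}` at the record is FOUND, given the two positivity facts. [cite: Balaban1985Variational, p.286] -/
theorem instBundleNeg (K k : ℕ) (Ω : ℕ → Set (Site (F.P K) 0)) (n : ℕ) [Fact (0 < (F.L : ℝ))] [Fact (0 < (F.P K).eta k)] :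
    Nonempty (NormedAddCommGroup (NegSizeOfRecord F N K k Ω n)) ∧ Nonempty (NormedSpace ℂ (NegSizeOfRecord F N K k Ω n))
      ∧ CompleteSpace (NegSizeOfRecord F N K k Ω n) :=
  ⟨⟨inferInstance⟩, ⟨inferInstance⟩, inferInstance⟩

/-! ## §6. The (19) presentation read on (115): `ev` -/

/-- **The presentation map** of `BgScheme.ev` at the record: a jet of (115) IS its bond function `b ↦ A′(b) ∈ M_N(ℂ)` (the `A′` of
`U′ = exp(iηA′)U₀`, (19) p. 281); ℂ-linear. [cite: Balaban1985Variational, (19) p.281, (115) p.294] -/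
def evOfRecord (K k : ℕ) (Ω : ℕ → Set (Site (F.P K) 0)) (U₀ : GaugeField (F.P K) 0 (SU N)) :
    Space115OfRecord F N K k Ω U₀ →ₗ[ℂ] (PBond (F.P K) 0 → Matrix (Fin N) (Fin N) ℂ) where
  toFun A := JetSup.equiv _ _ _ A
  map_add' _ _ := rfl
  map_smul' _ _ := rfl

variable {F N} in
/-- Unfolding: `ev A b = A b`. [cite: Balaban1985Variational, (19) p.281] -/
theorem evOfRecord_apply (K k : ℕ) (Ω : ℕ → Set (Site (F.P K) 0)) (U₀ : GaugeField (F.P K) 0 (SU N))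
    (A : Space115OfRecord F N K k Ω U₀) (b : PBond (F.P K) 0) : evOfRecord F N K k Ω U₀ A b = JetSup.equiv _ _ _ A b := rfl

variable {F N} in
/-- The presentation is injective (a jet is determined by its bond function). [cite: Balaban1985Variational, (19) p.281] -/
theorem evOfRecord_injective (K k : ℕ) (Ω : ℕ → Set (Site (F.P K) 0)) (U₀ : GaugeField (F.P K) 0 (SU N)) :
    Function.Injective (evOfRecord F N K k Ω U₀) := fun _ _ h => h

/-! ## §7. The type of Prop. 6 schemes over the record carriers -/

/-- **`BgScheme`s over the record carriers at background `U₀`**: the type `BgScheme F N 𝒴 𝒵 K k` of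
`Node00.BackgroundMapOfRecord` with `𝒴 := Space115OfRecord … U₀`, `𝒵 := NegSizeOfRecord … 3` (HONEST LABEL (2): one carrier per
background; a record instance is a family in `U₀` or a later dependent-carrier edition). [cite: Balaban1985Variational, (117) p.294] -/
abbrev BgSchemeOn (K k : ℕ) (Ω : ℕ → Set (Site (F.P K) 0)) (U₀ : GaugeField (F.P K) 0 (SU N))
    [Fact (0 < (F.L : ℝ))] [Fact (0 < (F.P K).eta k)] : Type :=
  BgScheme F N (Space115OfRecord F N K k Ω U₀) (NegSizeOfRecord F N K k Ω 3) K k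

end

end Literature.MathematicalPhysics.QuantumFieldTheory.Balaban1983to89.Node00
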